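import Summits.RiemannHypothesis.RiemannHypothesis.Theorems.WeilGroundStateGroundStatesConvergeToXiStubZeroSideTruncation
import Literature.NumberTheory.LFunctions.WeilExplicit
import Literature.NumberTheory.LFunctions.WeilExplicitArchTermProofs
import Literature.Analysis.Calculus.SmoothCutoff
import HarnessLib

/-!
# `WeilGroundState.GroundStatesConvergeToXi` — Bombieri's form of the archimedean term under plateau truncation
(crux item stmt-RiemannHypothesis-1527, route route-RiemannHypothesis-WeilGroundState; line `Sketch`,
stub `stub_archBombieri_truncation` (W12e); `--supports`)

Test functions of the EXPONENTIAL WEIL CLASS: `f : ℝ → ℂ` smooth with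
`‖f‖, ‖f'‖, ‖f''‖ ≤ C e^{-b₀|t|}`, `b₀ > 1/2`.  Plateau truncation `f_R = f · χ_R`
(`χ_R = Literature.Analysis.Calculus.cutoff R`: `= 1` on `|t| ≤ R − 1`, `= 0` on `|t| ≥ R`).

Bombieri's archimedean term (Bombieri 2000 Thm 2, transported by `x = e^t`) is
`weilArchTermBombieri g = −((log 4π + γ) g(0) + ∫₀^∞ B_g)` with the integrand
`B_g(t) = (e^{t/2}(g(t) + g(−t)) − 2 g(0))/(2 sinh t)`.

* `B_f` is integrable on `(0, ∞)`: near `0` the numerator is `O(t)` (`f ∈ C¹`, mean value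
  inequality on `[0, 1]`) and `sinh t ≥ t`; for `t ≥ 1` the numerator is `≤ 4C e^{t/2}` while
  `2 sinh t ≥ e^t/2`, so `‖B_f(t)‖ ≤ 8C e^{-t/2}`. Only `f ∈ C¹` and `‖f‖ ≤ C` are used.
* `weilArchTermBombieri f_R → weilArchTermBombieri f` (`R → ∞`): for `R ≥ 2`, `f_R(0) = f(0)` and
  `B_{f_R} = B_f` on `(0, 1]` (the plateau contains `[−1, 1]`), `‖B_{f_R}(t)‖ ≤ 8C e^{-t/2}` for
  `t ≥ 1` uniformly in `R` (`‖f_R‖ ≤ C`), and `B_{f_R}(t) = B_f(t)` as soon as `R ≥ |t| + 1`: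
  dominated convergence on `(0, ∞)` with the majorant `‖B_f‖ + 8C e^{-t/2}`.

No new definitions; no named fact is used.
-/

noncomputable section

set_option linter.dupNamespace false

open scoped Topology Real
open Filter Set MeasureTheory Complex

namespace Summit.RiemannHypothesis.RiemannHypothesis.Theorems.GroundStatesConvergeToXi

open Literature.NumberTheory.LFunctions

/-! ## Bombieri's integrand for a bounded `C¹` function -/

/-- `‖2 sinh x‖ = 2 sinh x` (in `ℂ`) for `x > 0`. [folklore] -/
theorem abTrunc_norm_two_mul_sinh {x : ℝ} (hx : 0 < x) :
    ‖(2 * Real.sinh x : ℂ)‖ = 2 * Real.sinh x := by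
  have hsinh : 0 < Real.sinh x := Real.sinh_pos_iff.2 hx
  rw [← Complex.ofReal_ofNat, ← Complex.ofReal_mul, Complex.norm_real,
    Real.norm_of_nonneg (by positivity)]

/-- The numerator `e^{x/2}(g(x) + g(−x)) − 2 g(0)` of Bombieri's integrand is `O(x)` at `0` for
`g ∈ C¹`: `‖·‖ ≤ M x` on `[0, 1]` (mean value inequality, the derivative being bounded on the
compact interval). [folklore] -/
theorem abTrunc_exists_norm_numerator_le {g : ℝ → ℂ} (hg : ContDiff ℝ 1 g) :
    ∃ M : ℝ, 0 ≤ M ∧ ∀ x ∈ Icc (0 : ℝ) 1,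
      ‖(Real.exp (x / 2) : ℂ) * (g x + g (-x)) - 2 * g 0‖ ≤ M * x := by
  set h : ℝ → ℂ := fun x => (Real.exp (x / 2) : ℂ) * (g x + g (-x)) with hh
  have he : ContDiff ℝ 1 fun x : ℝ => ((Real.exp (x / 2) : ℝ) : ℂ) := by
    have := Complex.ofRealCLM.contDiff.comp
      ((Real.contDiff_exp (n := 1)).comp (contDiff_id.div_const (2 : ℝ)))
    simpa [Function.comp_def] using this
  have hk : ContDiff ℝ 1 fun x : ℝ => g x + g (-x) := hg.add (hg.comp contDiff_neg)
  have hd : ContDiff ℝ 1 h := he.mul hk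
  have hcont : Continuous (deriv h) := hd.continuous_deriv le_rfl
  obtain ⟨M, hM⟩ := (isCompact_Icc (a := (0 : ℝ)) (b := 1)).exists_bound_of_continuousOn
    hcont.continuousOn
  have hM0 : 0 ≤ M := (norm_nonneg _).trans (hM 0 (left_mem_Icc.2 zero_le_one))
  refine ⟨M, hM0, fun x hx => ?_⟩
  have hdiff : ∀ y ∈ Icc (0 : ℝ) 1, DifferentiableAt ℝ h y := fun y _ =>
    (hd.differentiable one_ne_zero) y
  have hmv := (convex_Icc (0 : ℝ) 1).norm_image_sub_le_of_norm_deriv_le hdiff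
    (fun y hy => hM y hy) (left_mem_Icc.2 zero_le_one) hx
  have h0 : h 0 = 2 * g 0 := by simp [hh, two_mul]
  rw [h0, sub_zero, Real.norm_eq_abs, abs_of_nonneg hx.1] at hmv
  simpa [hh] using hmv

/-- For `‖g‖ ≤ K` and `t ≥ 1`: `‖B_g(t)‖ ≤ 8K e^{-t/2}` (the numerator is `≤ 4K e^{t/2}` and
`2 sinh t ≥ e^t/2`). [folklore] -/
theorem abTrunc_norm_integrand_le {g : ℝ → ℂ} {K : ℝ} (hK : ∀ t, ‖g t‖ ≤ K) {t : ℝ}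
    (ht : 1 ≤ t) :
    ‖((Real.exp (t / 2) : ℂ) * (g t + g (-t)) - 2 * g 0) / (2 * Real.sinh t : ℂ)‖ ≤
      8 * K * Real.exp (-(1 / 2) * t) := by
  have hK0 : 0 ≤ K := (norm_nonneg _).trans (hK 0)
  have ht0 : 0 < t := by linarith
  have hsinh : 0 < Real.sinh t := Real.sinh_pos_iff.2 ht0
  have h2s : 0 < 2 * Real.sinh t := by positivity
  rw [norm_div, abTrunc_norm_two_mul_sinh ht0, div_le_iff₀ h2s]
  have hE1 : 1 ≤ Real.exp (t / 2) := Real.one_le_exp (by positivity)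
  have hprod : Real.exp (-(1 / 2) * t) * Real.exp t = Real.exp (t / 2) := by
    rw [← Real.exp_add]; ring_nf
  have hex2 : (2 : ℝ) ≤ Real.exp t := by linarith [Real.add_one_le_exp t]
  have hexn : Real.exp (-t) ≤ 1 := Real.exp_le_one_iff.2 (by linarith)
  have h2s' : Real.exp t / 2 ≤ 2 * Real.sinh t := by rw [Real.sinh_eq]; linarith
  have hnum : ‖(Real.exp (t / 2) : ℂ) * (g t + g (-t)) - 2 * g 0‖ ≤ 4 * K * Real.exp (t / 2) := by
    refine (norm_sub_le _ _).trans ?_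
    rw [norm_mul, Complex.norm_real, Real.norm_of_nonneg (Real.exp_pos _).le, norm_mul,
      Complex.norm_two]
    have h1 : ‖g t + g (-t)‖ ≤ K + K := (norm_add_le _ _).trans (add_le_add (hK t) (hK (-t)))
    have h2 := hK 0
    nlinarith [mul_le_mul_of_nonneg_left h1 (Real.exp_pos (t / 2)).le,
      mul_le_mul_of_nonneg_left hE1 hK0, norm_nonneg (g 0)]
  calc ‖(Real.exp (t / 2) : ℂ) * (g t + g (-t)) - 2 * g 0‖ ≤ 4 * K * Real.exp (t / 2) := hnum
    _ = 8 * K * Real.exp (-(1 / 2) * t) * (Real.exp t / 2) := by rw [← hprod]; ring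
    _ ≤ 8 * K * Real.exp (-(1 / 2) * t) * (2 * Real.sinh t) := by gcongr

/-- **Bombieri's integrand is integrable** on `(0, ∞)` for a bounded `C¹` function `g`
(`‖g‖ ≤ K`): `‖B_g(t)‖ (2 sinh t) ≤ M t ≤ M sinh t` on `(0, 1]` and `‖B_g(t)‖ ≤ 8K e^{-t/2}` on
`[1, ∞)`, so `‖B_g(t)‖ ≤ (M e^{1/2}/2 + 8K) e^{-t/2}` throughout. [folklore] -/
theorem abTrunc_integrableOn_integrand {g : ℝ → ℂ} (hg : ContDiff ℝ 1 g) {K : ℝ}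
    (hK : ∀ t, ‖g t‖ ≤ K) :
    IntegrableOn (fun t : ℝ =>
      ((Real.exp (t / 2) : ℂ) * (g t + g (-t)) - 2 * g 0) / (2 * Real.sinh t : ℂ)) (Ioi 0) := by
  obtain ⟨M, hM0, hM⟩ := abTrunc_exists_norm_numerator_le hg
  have hK0 : 0 ≤ K := (norm_nonneg _).trans (hK 0)
  have hgc : Continuous g := hg.continuous
  set C : ℝ := M / 2 * Real.exp (1 / 2) + 8 * K with hC
  refine Integrable.mono'
    ((exp_neg_integrableOn_Ioi 0 (by norm_num : (0 : ℝ) < 1 / 2)).const_mul C) ?_ ?_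
  · refine (Measurable.div ?_ ?_).aestronglyMeasurable
    · exact (by fun_prop :
        Continuous fun x : ℝ => (Real.exp (x / 2) : ℂ) * (g x + g (-x)) - 2 * g 0).measurable
    · exact (by fun_prop : Continuous fun x : ℝ => (2 * Real.sinh x : ℂ)).measurable
  · refine (ae_restrict_iff' measurableSet_Ioi).2 (Eventually.of_forall fun x (hx : 0 < x) => ?_)
    rcases le_or_gt x 1 with hx1 | hx1
    · -- near zero: `‖numerator‖ ≤ M x ≤ M sinh x`
      have hsinh : 0 < Real.sinh x := Real.sinh_pos_iff.2 hx
      have h2s : 0 < 2 * Real.sinh x := by positivity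
      rw [norm_div, abTrunc_norm_two_mul_sinh hx, div_le_iff₀ h2s]
      have e1 : 1 ≤ Real.exp (1 / 2) * Real.exp (-(1 / 2) * x) := by
        rw [← Real.exp_add]; exact Real.one_le_exp (by linarith)
      have e2 : x ≤ Real.sinh x := Real.self_le_sinh_iff.2 hx.le
      calc ‖(Real.exp (x / 2) : ℂ) * (g x + g (-x)) - 2 * g 0‖ ≤ M * x := hM x ⟨hx.le, hx1⟩
        _ ≤ M * Real.sinh x := by gcongr
        _ ≤ M * Real.sinh x * (Real.exp (1 / 2) * Real.exp (-(1 / 2) * x)) :=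
            le_mul_of_one_le_right (by positivity) e1
        _ = M / 2 * Real.exp (1 / 2) * Real.exp (-(1 / 2) * x) * (2 * Real.sinh x) := by ring
        _ ≤ C * Real.exp (-(1 / 2) * x) * (2 * Real.sinh x) := by
            gcongr
            rw [hC]
            linarith [mul_nonneg (by norm_num : (0 : ℝ) ≤ 8) hK0]
    · -- at infinity
      calc ‖((Real.exp (x / 2) : ℂ) * (g x + g (-x)) - 2 * g 0) / (2 * Real.sinh x : ℂ)‖
          ≤ 8 * K * Real.exp (-(1 / 2) * x) := abTrunc_norm_integrand_le hK hx1.le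
        _ ≤ C * Real.exp (-(1 / 2) * x) := by
            gcongr
            rw [hC]
            have : 0 ≤ M / 2 * Real.exp (1 / 2) := by positivity
            linarith

/-! ## The stub -/

section Stub

open Literature.Analysis.Calculus

/-- **Stub W12e — `archBombieri_truncation` (RH-free).**  For `f` in the exponential Weil class
(`f` smooth, `‖f‖, ‖f'‖, ‖f''‖ ≤ C e^{-b₀|t|}`, `b₀ > 1/2`) Bombieri's archimedean integrand
`B_f(t) = (e^{t/2}(f(t) + f(−t)) − 2 f(0))/(2 sinh t)` is integrable on `(0, ∞)` (near `0` the
numerator is `O(t)` by the mean value inequality, at infinity `‖B_f(t)‖ ≤ 8C e^{-t/2}`), and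
`weilArchTermBombieri f_R → weilArchTermBombieri f` for the plateau truncations `f_R = f χ_R`:
for `R ≥ 2`, `f_R(0) = f(0)`, `B_{f_R} = B_f` on `(0, 1]`, `‖B_{f_R}(t)‖ ≤ 8C e^{-t/2}` for `t ≥ 1`
uniformly in `R`, and `B_{f_R}(t) = B_f(t)` once `R ≥ |t| + 1` (dominated convergence on
`(0, ∞)` with the majorant `‖B_f‖ + 8C e^{-t/2}`). [folklore] -/
theorem stub_archBombieri_truncation :
    ∀ (f : ℝ → ℂ) (C b₀ : ℝ), ContDiff ℝ (⊤ : ℕ∞) f → 1 / 2 < b₀ →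
      (∀ t, ‖f t‖ ≤ C * Real.exp (-(b₀ * |t|))) →
      (∀ t, ‖deriv f t‖ ≤ C * Real.exp (-(b₀ * |t|))) →
      (∀ t, ‖deriv (deriv f) t‖ ≤ C * Real.exp (-(b₀ * |t|))) →
      IntegrableOn (fun t : ℝ =>
          ((Real.exp (t / 2) : ℂ) * (f t + f (-t)) - 2 * f 0) / (2 * Real.sinh t : ℂ)) (Ioi 0) ∧
      Tendsto (fun R : ℝ =>
          weilArchTermBombieri
            (fun t : ℝ => f t * ((Literature.Analysis.Calculus.cutoff R t : ℝ) : ℂ)))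
        atTop (𝓝 (weilArchTermBombieri f)) := by
  intro f C b₀ hf hb h0 _ _
  have hf1 : ContDiff ℝ 1 f := hf.of_le (by simp)
  have hfc : Continuous f := hf.continuous
  have hC0 : 0 ≤ C := by
    have h := h0 0
    simp only [abs_zero, mul_zero, neg_zero, Real.exp_zero, mul_one] at h
    exact (norm_nonneg _).trans h
  -- `‖f‖ ≤ C` and `‖f χ_R‖ ≤ C`
  have hfC : ∀ t, ‖f t‖ ≤ C := fun t =>
    (h0 t).trans (mul_le_of_le_one_right hC0 (Real.exp_le_one_iff.2
      (neg_nonpos.2 (mul_nonneg (by linarith) (abs_nonneg t)))))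
  have hχC : ∀ R t, ‖f t * ((cutoff R t : ℝ) : ℂ)‖ ≤ C := fun R t => by
    rw [norm_mul, Complex.norm_real, Real.norm_eq_abs, abs_of_nonneg (cutoff_nonneg R t)]
    exact (mul_le_of_le_one_right (norm_nonneg _) (cutoff_le_one R t)).trans (hfC t)
  have hA := abTrunc_integrableOn_integrand hf1 hfC
  refine ⟨hA, ?_⟩
  -- the integrands agree on the plateau `|t| ≤ R - 1`
  have hplateau : ∀ R t : ℝ, |t| ≤ R - 1 →
      ((Real.exp (t / 2) : ℂ) * (f t * ((cutoff R t : ℝ) : ℂ) +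
          f (-t) * ((cutoff R (-t) : ℝ) : ℂ)) - 2 * (f 0 * ((cutoff R 0 : ℝ) : ℂ))) /
          (2 * Real.sinh t : ℂ) =
        ((Real.exp (t / 2) : ℂ) * (f t + f (-t)) - 2 * f 0) / (2 * Real.sinh t : ℂ) := by
    intro R t ht
    have h0' : |(0 : ℝ)| ≤ R - 1 := by rw [abs_zero]; linarith [abs_nonneg t]
    have ht' : |(-t)| ≤ R - 1 := by rwa [abs_neg]
    rw [cutoff_eq_one ht, cutoff_eq_one ht', cutoff_eq_one h0']
    simp only [Complex.ofReal_one, mul_one]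
  -- dominated convergence on `(0, ∞)`
  have key : Tendsto (fun R : ℝ => ∫ t in Ioi (0 : ℝ),
      ((Real.exp (t / 2) : ℂ) * (f t * ((cutoff R t : ℝ) : ℂ) +
          f (-t) * ((cutoff R (-t) : ℝ) : ℂ)) - 2 * (f 0 * ((cutoff R 0 : ℝ) : ℂ))) /
          (2 * Real.sinh t : ℂ)) atTop
      (𝓝 (∫ t in Ioi (0 : ℝ),
        ((Real.exp (t / 2) : ℂ) * (f t + f (-t)) - 2 * f 0) / (2 * Real.sinh t : ℂ))) := by
    refine tendsto_integral_filter_of_dominated_convergence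
      (fun t : ℝ => ‖((Real.exp (t / 2) : ℂ) * (f t + f (-t)) - 2 * f 0) / (2 * Real.sinh t : ℂ)‖ +
        8 * C * Real.exp (-(1 / 2) * t))
      (Eventually.of_forall fun R => ?_) ?_
      (hA.norm.add ((exp_neg_integrableOn_Ioi 0 (by norm_num : (0 : ℝ) < 1 / 2)).const_mul (8 * C)))
      (ae_of_all _ fun t => ?_)
    · -- measurability
      have hχc : Continuous (cutoff R) := (contDiff_cutoff R (n := 0)).continuous
      refine (Measurable.div ?_ ?_).aestronglyMeasurable
      · exact (by fun_prop : Continuous fun t : ℝ =>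
          (Real.exp (t / 2) : ℂ) * (f t * ((cutoff R t : ℝ) : ℂ) +
            f (-t) * ((cutoff R (-t) : ℝ) : ℂ)) - 2 * (f 0 * ((cutoff R 0 : ℝ) : ℂ))).measurable
      · exact (by fun_prop : Continuous fun x : ℝ => (2 * Real.sinh x : ℂ)).measurable
    · -- domination, for `R ≥ 2`
      filter_upwards [eventually_ge_atTop (2 : ℝ)] with R hR
      refine (ae_restrict_iff' measurableSet_Ioi).2 (Eventually.of_forall fun t (ht : 0 < t) => ?_)
      rcases le_or_gt t 1 with ht1 | ht1
      · rw [hplateau R t (by rw [abs_of_pos ht]; linarith)]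
        exact le_add_of_nonneg_right
          (mul_nonneg (mul_nonneg (by norm_num) hC0) (Real.exp_pos _).le)
      · exact (abTrunc_norm_integrand_le (hχC R) ht1.le).trans
          (le_add_of_nonneg_left (norm_nonneg _))
    · -- pointwise limit: the integrands agree once `R ≥ |t| + 1`
      refine tendsto_const_nhds.congr' ?_
      filter_upwards [eventually_ge_atTop (|t| + 1)] with R hR
      exact (hplateau R t (by linarith)).symm
  -- `f_R(0) = f(0)` for `R ≥ 1`
  have hlim0 : Tendsto (fun R : ℝ => (Real.log (4 * π) + Real.eulerMascheroniConstant : ℂ) *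
      (f 0 * ((cutoff R 0 : ℝ) : ℂ))) atTop
      (𝓝 ((Real.log (4 * π) + Real.eulerMascheroniConstant : ℂ) * f 0)) := by
    refine tendsto_const_nhds.congr' ?_
    filter_upwards [eventually_ge_atTop (1 : ℝ)] with R hR
    rw [cutoff_eq_one (by rw [abs_zero]; linarith), Complex.ofReal_one, mul_one]
  exact (hlim0.add key).neg

end Stub

end Summit.RiemannHypothesis.RiemannHypothesis.Theorems.GroundStatesConvergeToXi

end
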